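import Summits.QuantumFields.YangMills.Theorems.UnitScaleTiltProp7CovPinJunkPhi
import Mathlib.Algebra.Order.Chebyshev
import HarnessLib

/-!
# Route `UnitScaleTilt`, crux K1 «MinimiserStabilityRegPr» (stmt-QuantumFields-19200), route-R E′ path (α′), (E1-b) covariant, row (hK₂-cov) — FILE F4a′-cov «JUNK-Φ²»:
# THE `s²`-WEIGHTED FRAME-JUNK SUM `J₂ = Σ_{0<s≤m} s²‖Δ₁v‖²` AND THE CHARGE COMPARISON `‖Δ₁v(y)‖ ≤ ‖Δ_UV(y)‖ + (12τ₁ + 6τ₂ + 12τ₁²)·√𝓜` for the framed field `v = R(Fr⁻¹)V`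
# of a matrix field covariantly harmonic on the punctured pin ball (sibling of ✓ `Prop7CovPinJunkPhi.J1_le`, same letters)

Cell `ym3-torus`, width seat `ym3-torus-px11` (gen 3), LEAD of the (hK₂-cov) chain (routeR-w3 g6 WORDS (8)–(10)); LOCATE 19200 evidence #57 `LOCATE-HK2COV-px11g3.md` §1 rows (Q)(PIN).
`--kind proof --supports stmt-QuantumFields-19200 --as helper`, count-neutral.  THEOREMS ONLY (0 `def`, 0 `sorry`).  YM₃ on T³ is a ladder rung (R3) — not d = 4, not infinite
volume, not a mass gap, not the Clay problem; nothing here claims the stub, the crux or the gap.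

THE POINT.  F3c ✓p675494 needs, besides `J₁` (✓ `J1_le`), the weighted sum `J₂` (through `√(ℓ·J₂)`) and the charge `‖Δ₁v(y)‖`.  With the frame-free majorant `Φ` of ✓p674600,
`Φ ≤ 2τ₁·D + W` (`D` = first covariant differences at `z` and `z−e_μ`, `W` = the field terms), `s²Φ² ≤ 8τ₁²s²D² + 2s²W²`; `Σ s²D²` is paid by the spilled tent energy
✓ `sum_punctured_sq_hs_covD_le'` (`≤ 36d·𝓜`, the backward terms re-indexed with `s(w+e_μ) ≤ 2s(w)` off the pin and the pin bond apart), `Σ s²W²` by `m²` times the plain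
mass.  Outcome `J₂ ≲ (τ₁² + m²(τ₂ + 4τ₁²)²)·𝓜`, i.e. `√(ℓJ₂) ≍ eℓM` at the member (LOCATE #57 §2).  The charge comparison is the one-site version at the pin.

WHAT IS PROVED (ns `…Theorems.Prop7CovPinJunkPhiSq`; letters of ✓ `Prop7CovPinJunkPhi`: `d = 3`, unitary + bi-contractive `U`, bi-contractive `Fr`, pin `y`, `m ≥ 3`, `Δ_UV = 0` on
`{0 < s ≤ 2m}`, `𝓜 = Σ_{s≤2m+1} hs V`, rows `τ₁` on `{s ≤ m+1}`, backward differences `τ₂` on `{s ≤ m}`).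
* §1 letters `sq_two_mul_add_le`, (Ia) `sum_sq_norm_covD_le`, (Ib) `sum_sq_norm_covD_unshift_le`, (II) `sum_sq_field_terms_le`.
* §2 ★★★ `J2_le` — `Σ_{0<s≤m} s²·‖Δ₁v z‖² ≤ (26496·τ₁² + 162·m²·(2τ₂ + 8τ₁²)²)·𝓜`.
* §3 ★★ `norm_laplace_framed_centre_le` — `‖Δ₁v(y)‖ ≤ ‖Δ_UV(y)‖ + (12τ₁ + 6τ₂ + 12τ₁²)·√𝓜` (only the rows at `y`, `y − e_μ`).
HONEST SCOPE.  Bookkeeping with generous absolute constants; nothing of Bałaban's is asserted; F4b-cov is the sequel.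

References: M. Giaquinta, Princeton UP 1983 [Giaquinta1984] (Ch. III §1); T. Bałaban, CMP 99 (1985) 389–434 [Balaban1985BackgroundPropagators] ((3.8) p.392, (3.35) p.396).
-/

set_option autoImplicit false

noncomputable section

open scoped BigOperators Matrix.Norms.L2Operator Matrix

namespace Summit.QuantumFields.YangMills.Theorems.Prop7CovPinJunkPhiSq

open Literature.MathematicalPhysics.QuantumFieldTheory.Balaban1983to89
open Finset
open LatticeFieldCalculus (laplace)
open B9Eq39Adjoint (R covD divB)
open B9TorusCalculus (torusT torusT_apply)
open B3Taylor310LocalRemainder (tdist_comm tdist_self tdist_triangle)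
open Summit.QuantumFields.YangMills.Theorems.Prop7CovPinJunkSums (tdist_shift_le_succ tdist_le_tdist_shift_succ norm_le_sqrt_hs)
open Summit.QuantumFields.YangMills.Theorems.Prop7CovPinCharge (norm_framed_eq norm_framed_fdiff_le framedLink_bicontr norm_laplace_one_framed_le covLaplace_framed_eq_zero)
open Summit.QuantumFields.YangMills.Theorems.Prop7FramedCovLaplacian (R_inv_frame_covLaplace norm_covLaplace_sub_laplace_one_le_T)
open Summit.QuantumFields.YangMills.Theorems.Prop7PinnedSupOfGradient (norm_R_eq)
open Summit.QuantumFields.YangMills.Theorems.Prop7CovPinJunkPhi (sum_punctured_sq_hs_covD_le' norm_le_sqrt_mass norm_covD_le_add tdist_unshift_le_succ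
  sum_unshift_le sum_shift_le sum_punctured_le_ball sum_ball_le_centre_add)

variable {P : Params} {i : ℕ} {N : ℕ}

section Main

variable (U : Fin P.d → Site P i → (Matrix (Fin N) (Fin N) ℂ)ˣ) (Fr : Site P i → (Matrix (Fin N) (Fin N) ℂ)ˣ)

/-! ## §1 Letters for `J₂` -/

omit U Fr in
/-- `(2τ₁D + W)² ≤ 8τ₁²D² + 2W²`. [folklore] -/
theorem sq_two_mul_add_le (τ D W : ℝ) : (2 * τ * D + W) ^ 2 ≤ 8 * τ ^ 2 * D ^ 2 + 2 * W ^ 2 := by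
  nlinarith [sq_nonneg (2 * τ * D - W)]

omit Fr in
/-- (Ia) `Σ_{0<s≤m} s²·Σ_μ ‖D_μV z‖² ≤ 36d·𝓜` (op norm ≤ HS, ✓ `sum_punctured_sq_hs_covD_le'` with `R = m − 1`). [folklore] -/
theorem sum_sq_norm_covD_le (hUu : ∀ ν x, (U ν x : Matrix (Fin N) (Fin N) ℂ) ∈ unitary (Matrix (Fin N) (Fin N) ℂ))
    (V : Site P i → Matrix (Fin N) (Fin N) ℂ) (y : Site P i) {m : ℕ} (hm : 3 ≤ m)
    (hV : ∀ z, 0 < Site.tdist z y → Site.tdist z y ≤ 2 * m → divB (torusT P i) U (fun μ => covD (torusT P i) U μ V) z = 0) :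
    ∑ z ∈ Finset.univ.filter (fun z : Site P i => 1 ≤ Site.tdist z y ∧ Site.tdist z y ≤ m), ((Site.tdist z y : ℕ) : ℝ) ^ 2 * ∑ μ : Fin P.d, ‖covD (torusT P i) U μ V z‖ ^ 2
      ≤ 36 * P.d * ∑ z ∈ Finset.univ.filter (fun z : Site P i => Site.tdist z y ≤ 2 * m + 1), ∑ j : Fin N, ∑ k : Fin N, ‖(V z) j k‖ ^ 2 := by
  classical
  have hE := sum_punctured_sq_hs_covD_le' hUu V y (R := m - 1) (by omega) (fun z hz0 hz1 => hV z hz0 (by omega))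
  have e1 : m - 1 + 2 = m + 1 := by omega
  have e2 : 2 * (m - 1) + 3 = 2 * m + 1 := by omega
  rw [e1, e2] at hE
  refine le_trans ?_ hE
  refine le_trans (Finset.sum_le_sum fun z _ => ?_)
    (Finset.sum_le_sum_of_subset_of_nonneg (fun z hz => ?_) fun _ _ _ => Finset.sum_nonneg fun _ _ => by positivity)
  · rw [Finset.mul_sum]
    exact Finset.sum_le_sum fun μ _ => mul_le_mul_of_nonneg_left (MatrixNorms.opNorm_sq_le_sum_norm_sq _) (sq_nonneg _)
  · rw [Finset.mem_filter] at hz ⊢; exact ⟨hz.1, hz.2.1, by omega⟩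

omit Fr in
/-- (Ib) the backward terms, re-indexed (`s(w+e_μ) ≤ 2s(w)` off the pin; the pin bond apart): `Σ_{0<s≤m} s²·Σ_μ ‖D_μV(z−e_μ)‖² ≤ 12·𝓜 + 4·36d·𝓜`. [folklore] -/
theorem sum_sq_norm_covD_unshift_le (hd : P.d = 3) (hUu : ∀ ν x, (U ν x : Matrix (Fin N) (Fin N) ℂ) ∈ unitary (Matrix (Fin N) (Fin N) ℂ))
    (hU : ∀ (κ : Fin P.d) (w : Site P i), ‖(U κ w : Matrix (Fin N) (Fin N) ℂ)‖ ≤ 1 ∧ ‖(((U κ w)⁻¹ : (Matrix (Fin N) (Fin N) ℂ)ˣ) : Matrix (Fin N) (Fin N) ℂ)‖ ≤ 1)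
    (V : Site P i → Matrix (Fin N) (Fin N) ℂ) (y : Site P i) {m : ℕ} (hm : 3 ≤ m)
    (hV : ∀ z, 0 < Site.tdist z y → Site.tdist z y ≤ 2 * m → divB (torusT P i) U (fun μ => covD (torusT P i) U μ V) z = 0) :
    ∑ z ∈ Finset.univ.filter (fun z : Site P i => 1 ≤ Site.tdist z y ∧ Site.tdist z y ≤ m),
        ((Site.tdist z y : ℕ) : ℝ) ^ 2 * ∑ μ : Fin P.d, ‖covD (torusT P i) U μ V (z.unshift μ)‖ ^ 2
      ≤ 12 * (∑ z ∈ Finset.univ.filter (fun z : Site P i => Site.tdist z y ≤ 2 * m + 1), ∑ j : Fin N, ∑ k : Fin N, ‖(V z) j k‖ ^ 2)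
        + 4 * (36 * P.d * ∑ z ∈ Finset.univ.filter (fun z : Site P i => Site.tdist z y ≤ 2 * m + 1), ∑ j : Fin N, ∑ k : Fin N, ‖(V z) j k‖ ^ 2) := by
  classical
  set B := Finset.univ.filter (fun z : Site P i => 1 ≤ Site.tdist z y ∧ Site.tdist z y ≤ m) with hBdef
  set Mass := ∑ z ∈ Finset.univ.filter (fun z : Site P i => Site.tdist z y ≤ 2 * m + 1), ∑ j : Fin N, ∑ k : Fin N, ‖(V z) j k‖ ^ 2 with hMass
  have hMass0 : 0 ≤ Mass := Finset.sum_nonneg fun _ _ => Finset.sum_nonneg fun _ _ => Finset.sum_nonneg fun _ _ => sq_nonneg _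
  have hmass_pt : ∀ w, Site.tdist w y ≤ 2 * m + 1 → ‖V w‖ ≤ Real.sqrt Mass := fun w hw => norm_le_sqrt_mass V y (2 * m + 1) w hw
  have hqq : Real.sqrt Mass ^ 2 = Mass := Real.sq_sqrt hMass0
  have hE := sum_punctured_sq_hs_covD_le' hUu V y (R := m - 1) (by omega) (fun z hz0 hz1 => hV z hz0 (by omega))
  have e1 : m - 1 + 2 = m + 1 := by omega
  have e2 : 2 * (m - 1) + 3 = 2 * m + 1 := by omega
  rw [e1, e2] at hE
  -- per `μ`
  have hμ : ∀ μ : Fin P.d, ∑ z ∈ B, ((Site.tdist z y : ℕ) : ℝ) ^ 2 * ‖covD (torusT P i) U μ V (z.unshift μ)‖ ^ 2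
      ≤ 4 * Mass + 4 * ∑ w ∈ Finset.univ.filter (fun w : Site P i => 1 ≤ Site.tdist w y ∧ Site.tdist w y ≤ m + 1),
          ((Site.tdist w y : ℕ) : ℝ) ^ 2 * ∑ j : Fin N, ∑ k : Fin N, ‖(covD (torusT P i) U μ V w) j k‖ ^ 2 := by
    intro μ
    -- re-index with `G w := s(w+e_μ)²‖D_μV w‖²`
    have hre : ∑ z ∈ B, ((Site.tdist z y : ℕ) : ℝ) ^ 2 * ‖covD (torusT P i) U μ V (z.unshift μ)‖ ^ 2
        = ∑ z ∈ B, (fun w => ((Site.tdist (w.shift μ) y : ℕ) : ℝ) ^ 2 * ‖covD (torusT P i) U μ V w‖ ^ 2) (z.unshift μ) :=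
      Finset.sum_congr rfl fun z _ => by simp only [Site.shift_unshift]
    rw [hre]
    refine (sum_unshift_le y m μ (fun w => ((Site.tdist (w.shift μ) y : ℕ) : ℝ) ^ 2 * ‖covD (torusT P i) U μ V w‖ ^ 2) fun w => by positivity).trans ?_
    refine (sum_ball_le_centre_add y (m + 1) (fun w => ((Site.tdist (w.shift μ) y : ℕ) : ℝ) ^ 2 * ‖covD (torusT P i) U μ V w‖ ^ 2) fun w => by positivity).trans ?_
    have hy : ((Site.tdist (y.shift μ) y : ℕ) : ℝ) ^ 2 * ‖covD (torusT P i) U μ V y‖ ^ 2 ≤ 4 * Mass := by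
      have hs1 : ((Site.tdist (y.shift μ) y : ℕ) : ℝ) ^ 2 ≤ 1 := by
        have h := tdist_shift_le_succ y y μ
        rw [tdist_self] at h
        have h' : ((Site.tdist (y.shift μ) y : ℕ) : ℝ) ≤ 1 := by exact_mod_cast h
        nlinarith [Nat.cast_nonneg (α := ℝ) (Site.tdist (y.shift μ) y)]
      have hcov : ‖covD (torusT P i) U μ V y‖ ≤ 2 * Real.sqrt Mass := by
        refine (norm_covD_le_add hU V μ y).trans ?_
        have h1 := hmass_pt (y.shift μ) (by have := tdist_shift_le_succ y y μ; rw [tdist_self] at this; omega)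
        have h2 := hmass_pt y (by rw [tdist_self]; omega)
        linarith
      have hn : 0 ≤ ‖covD (torusT P i) U μ V y‖ := norm_nonneg _
      have hcov2 : ‖covD (torusT P i) U μ V y‖ ^ 2 ≤ 4 * Mass := by nlinarith [hcov, hqq, Real.sqrt_nonneg Mass]
      nlinarith [hcov2, sq_nonneg ‖covD (torusT P i) U μ V y‖]
    have hoff : ∑ w ∈ Finset.univ.filter (fun w : Site P i => 1 ≤ Site.tdist w y ∧ Site.tdist w y ≤ m + 1),
          ((Site.tdist (w.shift μ) y : ℕ) : ℝ) ^ 2 * ‖covD (torusT P i) U μ V w‖ ^ 2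
        ≤ 4 * ∑ w ∈ Finset.univ.filter (fun w : Site P i => 1 ≤ Site.tdist w y ∧ Site.tdist w y ≤ m + 1),
            ((Site.tdist w y : ℕ) : ℝ) ^ 2 * ∑ j : Fin N, ∑ k : Fin N, ‖(covD (torusT P i) U μ V w) j k‖ ^ 2 := by
      rw [Finset.mul_sum]
      refine Finset.sum_le_sum fun w hw => ?_
      rw [Finset.mem_filter] at hw
      have hs : ((Site.tdist (w.shift μ) y : ℕ) : ℝ) ≤ 2 * ((Site.tdist w y : ℕ) : ℝ) := by
        have h' : ((Site.tdist (w.shift μ) y : ℕ) : ℝ) ≤ ((Site.tdist w y : ℕ) : ℝ) + 1 := by exact_mod_cast tdist_shift_le_succ w y μ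
        have h1 : (1 : ℝ) ≤ ((Site.tdist w y : ℕ) : ℝ) := by exact_mod_cast hw.2.1
        linarith
      have hsq' : ((Site.tdist (w.shift μ) y : ℕ) : ℝ) ^ 2 ≤ 4 * ((Site.tdist w y : ℕ) : ℝ) ^ 2 := by
        nlinarith [Nat.cast_nonneg (α := ℝ) (Site.tdist (w.shift μ) y)]
      calc ((Site.tdist (w.shift μ) y : ℕ) : ℝ) ^ 2 * ‖covD (torusT P i) U μ V w‖ ^ 2
          ≤ (4 * ((Site.tdist w y : ℕ) : ℝ) ^ 2) * ∑ j : Fin N, ∑ k : Fin N, ‖(covD (torusT P i) U μ V w) j k‖ ^ 2 :=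
            mul_le_mul hsq' (MatrixNorms.opNorm_sq_le_sum_norm_sq _) (sq_nonneg _) (by positivity)
        _ = _ := by ring
    linarith
  -- sum over `μ`
  have hd' : (P.d : ℝ) = 3 := by exact_mod_cast hd
  calc ∑ z ∈ B, ((Site.tdist z y : ℕ) : ℝ) ^ 2 * ∑ μ : Fin P.d, ‖covD (torusT P i) U μ V (z.unshift μ)‖ ^ 2
      = ∑ μ : Fin P.d, ∑ z ∈ B, ((Site.tdist z y : ℕ) : ℝ) ^ 2 * ‖covD (torusT P i) U μ V (z.unshift μ)‖ ^ 2 := by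
        rw [Finset.sum_comm]; exact Finset.sum_congr rfl fun z _ => by rw [Finset.mul_sum]
    _ ≤ ∑ μ : Fin P.d, (4 * Mass + 4 * ∑ w ∈ Finset.univ.filter (fun w : Site P i => 1 ≤ Site.tdist w y ∧ Site.tdist w y ≤ m + 1),
          ((Site.tdist w y : ℕ) : ℝ) ^ 2 * ∑ j : Fin N, ∑ k : Fin N, ‖(covD (torusT P i) U μ V w) j k‖ ^ 2) := Finset.sum_le_sum fun μ _ => hμ μ
    _ = 4 * P.d * Mass + 4 * ∑ w ∈ Finset.univ.filter (fun w : Site P i => 1 ≤ Site.tdist w y ∧ Site.tdist w y ≤ m + 1), ∑ μ : Fin P.d,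
          ((Site.tdist w y : ℕ) : ℝ) ^ 2 * ∑ j : Fin N, ∑ k : Fin N, ‖(covD (torusT P i) U μ V w) j k‖ ^ 2 := by
        rw [Finset.sum_add_distrib, Finset.sum_const, Finset.card_univ, Fintype.card_fin, nsmul_eq_mul, ← Finset.mul_sum, Finset.sum_comm]
        ring
    _ ≤ 12 * Mass + 4 * (36 * P.d * Mass) := by
        have hE' := hE
        rw [hd'] at hE' ⊢
        linarith

omit U Fr in
/-- (II) the field terms: `Σ_{0<s≤m} s²·(Σ_μ(‖V(z+e_μ)‖ + ‖V z‖ + ‖V(z−e_μ)‖))² ≤ 81·m²·𝓜` (`d = 3`). [folklore] -/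
theorem sum_sq_field_terms_le (hd : P.d = 3) (V : Site P i → Matrix (Fin N) (Fin N) ℂ) (y : Site P i) (m : ℕ) :
    ∑ z ∈ Finset.univ.filter (fun z : Site P i => 1 ≤ Site.tdist z y ∧ Site.tdist z y ≤ m),
        ((Site.tdist z y : ℕ) : ℝ) ^ 2 * (∑ μ : Fin P.d, (‖V (z.shift μ)‖ + ‖V z‖ + ‖V (z.unshift μ)‖)) ^ 2
      ≤ 81 * (m : ℝ) ^ 2 * ∑ z ∈ Finset.univ.filter (fun z : Site P i => Site.tdist z y ≤ 2 * m + 1), ∑ j : Fin N, ∑ k : Fin N, ‖(V z) j k‖ ^ 2 := by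
  classical
  set B := Finset.univ.filter (fun z : Site P i => 1 ≤ Site.tdist z y ∧ Site.tdist z y ≤ m) with hBdef
  set Mass := ∑ z ∈ Finset.univ.filter (fun z : Site P i => Site.tdist z y ≤ 2 * m + 1), ∑ j : Fin N, ∑ k : Fin N, ‖(V z) j k‖ ^ 2 with hMass
  have hd' : (P.d : ℝ) = 3 := by exact_mod_cast hd
  have hsq : ∀ z, (∑ μ : Fin P.d, (‖V (z.shift μ)‖ + ‖V z‖ + ‖V (z.unshift μ)‖)) ^ 2
      ≤ 9 * ∑ μ : Fin P.d, (‖V (z.shift μ)‖ ^ 2 + ‖V z‖ ^ 2 + ‖V (z.unshift μ)‖ ^ 2) := by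
    intro z
    have h := sq_sum_le_card_mul_sum_sq (s := (Finset.univ : Finset (Fin P.d))) (f := fun μ => ‖V (z.shift μ)‖ + ‖V z‖ + ‖V (z.unshift μ)‖)
    rw [Finset.card_univ, Fintype.card_fin] at h
    have h0 : (∑ μ : Fin P.d, (‖V (z.shift μ)‖ + ‖V z‖ + ‖V (z.unshift μ)‖)) ^ 2 ≤ 3 * ∑ μ : Fin P.d, (‖V (z.shift μ)‖ + ‖V z‖ + ‖V (z.unshift μ)‖) ^ 2 := by
      have h'' : (∑ μ : Fin P.d, (‖V (z.shift μ)‖ + ‖V z‖ + ‖V (z.unshift μ)‖)) ^ 2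
          ≤ (P.d : ℝ) * ∑ μ : Fin P.d, (‖V (z.shift μ)‖ + ‖V z‖ + ‖V (z.unshift μ)‖) ^ 2 := by exact_mod_cast h
      rwa [hd'] at h''
    refine h0.trans ?_
    -- `(a+b+c)² ≤ 3(a²+b²+c²)` (≡ lit `MatomakiRadziwillL14.sq_add_three_le`; inlined rather than importing a sieve module)
    have h3 : ∀ a b c : ℝ, (a + b + c) ^ 2 ≤ 3 * (a ^ 2 + b ^ 2 + c ^ 2) := fun a b c => by
      nlinarith [sq_nonneg (a - b), sq_nonneg (b - c), sq_nonneg (a - c)]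
    have h3s := Finset.sum_le_sum (s := (Finset.univ : Finset (Fin P.d))) fun μ _ => h3 ‖V (z.shift μ)‖ ‖V z‖ ‖V (z.unshift μ)‖
    rw [← Finset.mul_sum] at h3s
    linarith
  have hs2 : ∀ z ∈ B, ((Site.tdist z y : ℕ) : ℝ) ^ 2 ≤ (m : ℝ) ^ 2 := by
    intro z hz
    rw [hBdef, Finset.mem_filter] at hz
    have : ((Site.tdist z y : ℕ) : ℝ) ≤ m := by exact_mod_cast hz.2.2
    exact pow_le_pow_left₀ (Nat.cast_nonneg _) this 2
  have hsub : ∑ w ∈ Finset.univ.filter (fun w : Site P i => Site.tdist w y ≤ m + 1), ‖V w‖ ^ 2 ≤ Mass := by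
    refine le_trans (Finset.sum_le_sum fun w _ => MatrixNorms.opNorm_sq_le_sum_norm_sq (V w)) ?_
    refine Finset.sum_le_sum_of_subset_of_nonneg (fun w hw => ?_) fun _ _ _ => Finset.sum_nonneg fun _ _ => Finset.sum_nonneg fun _ _ => sq_nonneg _
    rw [Finset.mem_filter] at hw ⊢; exact ⟨hw.1, by omega⟩
  have hfam : ∀ μ : Fin P.d, ∑ z ∈ B, (‖V (z.shift μ)‖ ^ 2 + ‖V z‖ ^ 2 + ‖V (z.unshift μ)‖ ^ 2) ≤ 3 * Mass := by
    intro μ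
    have h1 := (sum_shift_le y m μ (fun w => ‖V w‖ ^ 2) fun _ => sq_nonneg _).trans hsub
    have h2 := (sum_punctured_le_ball y m (fun w => ‖V w‖ ^ 2) fun _ => sq_nonneg _).trans hsub
    have h3 := (sum_unshift_le y m μ (fun w => ‖V w‖ ^ 2) fun _ => sq_nonneg _).trans hsub
    rw [Finset.sum_add_distrib, Finset.sum_add_distrib]
    linarith
  calc _ ≤ ∑ z ∈ B, (m : ℝ) ^ 2 * (9 * ∑ μ : Fin P.d, (‖V (z.shift μ)‖ ^ 2 + ‖V z‖ ^ 2 + ‖V (z.unshift μ)‖ ^ 2)) :=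
        Finset.sum_le_sum fun z hz => mul_le_mul (hs2 z hz) (hsq z) (sq_nonneg _) (sq_nonneg _)
    _ = 9 * (m : ℝ) ^ 2 * ∑ z ∈ B, ∑ μ : Fin P.d, (‖V (z.shift μ)‖ ^ 2 + ‖V z‖ ^ 2 + ‖V (z.unshift μ)‖ ^ 2) := by
        rw [Finset.mul_sum]; exact Finset.sum_congr rfl fun z _ => by ring
    _ = 9 * (m : ℝ) ^ 2 * ∑ μ : Fin P.d, ∑ z ∈ B, (‖V (z.shift μ)‖ ^ 2 + ‖V z‖ ^ 2 + ‖V (z.unshift μ)‖ ^ 2) := by rw [Finset.sum_comm]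
    _ ≤ 9 * (m : ℝ) ^ 2 * ∑ _μ : Fin P.d, (3 * Mass) := mul_le_mul_of_nonneg_left (Finset.sum_le_sum fun μ _ => hfam μ) (by positivity)
    _ = 81 * (m : ℝ) ^ 2 * Mass := by rw [Finset.sum_const, Finset.card_univ, Fintype.card_fin, nsmul_eq_mul, hd']; ring

/-! ## §2 ★★★ The weighted junk sum `J₂` -/

/-- ★★★ **THE `s²`-WEIGHTED JUNK SUM AT A PIN** (letters of ✓ `Prop7CovPinJunkPhi.J1_le`):
`Σ_{0<s≤m} s²·‖Δ₁(R(Fr⁻¹)V) z‖² ≤ (26496·τ₁² + 162·m²·(2τ₂ + 8τ₁²)²)·𝓜`, `𝓜 = Σ_{s≤2m+1} hs V` (`≍ e²ℓM²` at the member, so `√(ℓJ₂) ≍ eℓM`).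
[cite: Balaban1985BackgroundPropagators, (3.8) p.392, (3.35) p.396; Giaquinta1984, Ch. III §1] -/
theorem J2_le (hd : P.d = 3) (hUu : ∀ ν x, (U ν x : Matrix (Fin N) (Fin N) ℂ) ∈ unitary (Matrix (Fin N) (Fin N) ℂ))
    (hU : ∀ (κ : Fin P.d) (w : Site P i), ‖(U κ w : Matrix (Fin N) (Fin N) ℂ)‖ ≤ 1 ∧ ‖(((U κ w)⁻¹ : (Matrix (Fin N) (Fin N) ℂ)ˣ) : Matrix (Fin N) (Fin N) ℂ)‖ ≤ 1)
    (hFr : ∀ z, ‖(Fr z : Matrix (Fin N) (Fin N) ℂ)‖ ≤ 1 ∧ ‖(((Fr z)⁻¹ : (Matrix (Fin N) (Fin N) ℂ)ˣ) : Matrix (Fin N) (Fin N) ℂ)‖ ≤ 1)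
    (V : Site P i → Matrix (Fin N) (Fin N) ℂ) (y : Site P i) {m : ℕ} (hm : 3 ≤ m)
    (hV : ∀ z, 0 < Site.tdist z y → Site.tdist z y ≤ 2 * m → divB (torusT P i) U (fun μ => covD (torusT P i) U μ V) z = 0) {τ₁ τ₂ : ℝ}
    (hτ₁ : ∀ (μ : Fin P.d) (z : Site P i), Site.tdist z y ≤ m + 1 →
      ‖(((Fr z)⁻¹ * U μ z * Fr (torusT P i μ z) : (Matrix (Fin N) (Fin N) ℂ)ˣ) : Matrix (Fin N) (Fin N) ℂ) - 1‖ ≤ τ₁)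
    (hτ₂ : ∀ (μ : Fin P.d) (z : Site P i), Site.tdist z y ≤ m →
      ‖(((Fr z)⁻¹ * U μ z * Fr (torusT P i μ z) : (Matrix (Fin N) (Fin N) ℂ)ˣ) : Matrix (Fin N) (Fin N) ℂ)
        - (((Fr (z.unshift μ))⁻¹ * U μ (z.unshift μ) * Fr (torusT P i μ (z.unshift μ)) : (Matrix (Fin N) (Fin N) ℂ)ˣ) : Matrix (Fin N) (Fin N) ℂ)‖ ≤ τ₂) :
    ∑ z ∈ Finset.univ.filter (fun z : Site P i => 1 ≤ Site.tdist z y ∧ Site.tdist z y ≤ m),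
        ((Site.tdist z y : ℕ) : ℝ) ^ 2 * ‖laplace 1 (fun w => R (Fr w)⁻¹ (V w)) z‖ ^ 2
      ≤ (26496 * τ₁ ^ 2 + 162 * (m : ℝ) ^ 2 * (2 * τ₂ + 8 * τ₁ ^ 2) ^ 2)
          * ∑ z ∈ Finset.univ.filter (fun z : Site P i => Site.tdist z y ≤ 2 * m + 1), ∑ j : Fin N, ∑ k : Fin N, ‖(V z) j k‖ ^ 2 := by
  classical
  set B := Finset.univ.filter (fun z : Site P i => 1 ≤ Site.tdist z y ∧ Site.tdist z y ≤ m) with hBdef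
  set Mass := ∑ z ∈ Finset.univ.filter (fun z : Site P i => Site.tdist z y ≤ 2 * m + 1), ∑ j : Fin N, ∑ k : Fin N, ‖(V z) j k‖ ^ 2 with hMass
  have hMass0 : 0 ≤ Mass := Finset.sum_nonneg fun _ _ => Finset.sum_nonneg fun _ _ => Finset.sum_nonneg fun _ _ => sq_nonneg _
  have hτ₁0 : 0 ≤ τ₁ := (norm_nonneg _).trans (hτ₁ ⟨0, P.hd⟩ y (by rw [tdist_self]; omega))
  have hτ₂0 : 0 ≤ τ₂ := (norm_nonneg _).trans (hτ₂ ⟨0, P.hd⟩ y (by rw [tdist_self]; omega))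
  have hd' : (P.d : ℝ) = 3 := by exact_mod_cast hd
  -- pointwise: `‖Δ₁v z‖ ≤ 2τ₁·D z + c·E z`, `D z = Σ_μ(‖DV z‖ + ‖DV (z−e_μ)‖)`, `E z = Σ_μ(‖V₊‖+‖V‖+‖V₋‖)`, `c = 2τ₂ + 8τ₁²`
  have hΦ : ∀ z ∈ B, ‖laplace 1 (fun w => R (Fr w)⁻¹ (V w)) z‖
      ≤ 2 * τ₁ * (∑ μ : Fin P.d, (‖covD (torusT P i) U μ V z‖ + ‖covD (torusT P i) U μ V (z.unshift μ)‖))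
        + (2 * τ₂ + 8 * τ₁ ^ 2) * ∑ μ : Fin P.d, (‖V (z.shift μ)‖ + ‖V z‖ + ‖V (z.unshift μ)‖) := by
    intro z hz
    rw [hBdef, Finset.mem_filter] at hz
    have h := norm_laplace_one_framed_le U Fr hU hFr V z (hV z (by omega) (by omega)) (fun μ => hτ₁ μ z (by omega))
      (fun μ => hτ₁ μ _ (by have := tdist_unshift_le_succ z y μ; omega)) (fun μ => hτ₂ μ z hz.2.2)
    refine h.trans ?_
    rw [Finset.mul_sum, Finset.mul_sum, ← Finset.sum_add_distrib]
    refine Finset.sum_le_sum fun μ _ => ?_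
    have h1 : 0 ≤ ‖V (z.shift μ)‖ := norm_nonneg _
    have h2 : 0 ≤ ‖V z‖ := norm_nonneg _
    have h3 : 0 ≤ ‖V (z.unshift μ)‖ := norm_nonneg _
    nlinarith [mul_nonneg (sq_nonneg τ₁) h1, mul_nonneg (sq_nonneg τ₁) h2, mul_nonneg (sq_nonneg τ₁) h3, mul_nonneg hτ₂0 h1, mul_nonneg hτ₂0 h2]
  -- square with the weight
  have hsq : ∀ z ∈ B, ((Site.tdist z y : ℕ) : ℝ) ^ 2 * ‖laplace 1 (fun w => R (Fr w)⁻¹ (V w)) z‖ ^ 2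
      ≤ 8 * τ₁ ^ 2 * (((Site.tdist z y : ℕ) : ℝ) ^ 2 * (∑ μ : Fin P.d, (‖covD (torusT P i) U μ V z‖ + ‖covD (torusT P i) U μ V (z.unshift μ)‖)) ^ 2)
        + 2 * (2 * τ₂ + 8 * τ₁ ^ 2) ^ 2 * (((Site.tdist z y : ℕ) : ℝ) ^ 2 * (∑ μ : Fin P.d, (‖V (z.shift μ)‖ + ‖V z‖ + ‖V (z.unshift μ)‖)) ^ 2) := by
    intro z hz
    have h := hΦ z hz
    have hn : 0 ≤ ‖laplace 1 (fun w => R (Fr w)⁻¹ (V w)) z‖ := norm_nonneg _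
    have hb := sq_two_mul_add_le τ₁ (∑ μ : Fin P.d, (‖covD (torusT P i) U μ V z‖ + ‖covD (torusT P i) U μ V (z.unshift μ)‖))
      ((2 * τ₂ + 8 * τ₁ ^ 2) * ∑ μ : Fin P.d, (‖V (z.shift μ)‖ + ‖V z‖ + ‖V (z.unshift μ)‖))
    have hsq1 : ‖laplace 1 (fun w => R (Fr w)⁻¹ (V w)) z‖ ^ 2
        ≤ (2 * τ₁ * (∑ μ : Fin P.d, (‖covD (torusT P i) U μ V z‖ + ‖covD (torusT P i) U μ V (z.unshift μ)‖))
          + (2 * τ₂ + 8 * τ₁ ^ 2) * ∑ μ : Fin P.d, (‖V (z.shift μ)‖ + ‖V z‖ + ‖V (z.unshift μ)‖)) ^ 2 := pow_le_pow_left₀ hn h 2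
    have hs0 : 0 ≤ ((Site.tdist z y : ℕ) : ℝ) ^ 2 := sq_nonneg _
    have := mul_le_mul_of_nonneg_left (hsq1.trans hb) hs0
    nlinarith [this]
  -- the `D²` sum: `(Σ_μ(a+b))² ≤ 2d Σ_μ(a² + b²)`
  have hDsq : ∀ z, (∑ μ : Fin P.d, (‖covD (torusT P i) U μ V z‖ + ‖covD (torusT P i) U μ V (z.unshift μ)‖)) ^ 2
      ≤ 6 * (∑ μ : Fin P.d, ‖covD (torusT P i) U μ V z‖ ^ 2 + ∑ μ : Fin P.d, ‖covD (torusT P i) U μ V (z.unshift μ)‖ ^ 2) := by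
    intro z
    have h := sq_sum_le_card_mul_sum_sq (s := (Finset.univ : Finset (Fin P.d)))
      (f := fun μ => ‖covD (torusT P i) U μ V z‖ + ‖covD (torusT P i) U μ V (z.unshift μ)‖)
    rw [Finset.card_univ, Fintype.card_fin] at h
    have h'' : (∑ μ : Fin P.d, (‖covD (torusT P i) U μ V z‖ + ‖covD (torusT P i) U μ V (z.unshift μ)‖)) ^ 2
        ≤ (P.d : ℝ) * ∑ μ : Fin P.d, (‖covD (torusT P i) U μ V z‖ + ‖covD (torusT P i) U μ V (z.unshift μ)‖) ^ 2 := by exact_mod_cast h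
    rw [hd'] at h''
    refine h''.trans ?_
    rw [← Finset.sum_add_distrib, Finset.mul_sum, Finset.mul_sum]
    refine Finset.sum_le_sum fun μ _ => ?_
    nlinarith [sq_nonneg (‖covD (torusT P i) U μ V z‖ - ‖covD (torusT P i) U μ V (z.unshift μ)‖)]
  have hIa := sum_sq_norm_covD_le U hUu V y hm hV
  have hIb := sum_sq_norm_covD_unshift_le U hd hUu hU V y hm hV
  have hII := sum_sq_field_terms_le (N := N) hd V y m
  rw [hd'] at hIa hIb
  have hI : ∑ z ∈ B, ((Site.tdist z y : ℕ) : ℝ) ^ 2 * (∑ μ : Fin P.d, (‖covD (torusT P i) U μ V z‖ + ‖covD (torusT P i) U μ V (z.unshift μ)‖)) ^ 2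
      ≤ 3312 * Mass := by
    calc _ ≤ ∑ z ∈ B, ((Site.tdist z y : ℕ) : ℝ) ^ 2 * (6 * (∑ μ : Fin P.d, ‖covD (torusT P i) U μ V z‖ ^ 2 + ∑ μ : Fin P.d, ‖covD (torusT P i) U μ V (z.unshift μ)‖ ^ 2)) :=
          Finset.sum_le_sum fun z _ => mul_le_mul_of_nonneg_left (hDsq z) (sq_nonneg _)
      _ = 6 * (∑ z ∈ B, ((Site.tdist z y : ℕ) : ℝ) ^ 2 * ∑ μ : Fin P.d, ‖covD (torusT P i) U μ V z‖ ^ 2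
            + ∑ z ∈ B, ((Site.tdist z y : ℕ) : ℝ) ^ 2 * ∑ μ : Fin P.d, ‖covD (torusT P i) U μ V (z.unshift μ)‖ ^ 2) := by
          rw [← Finset.sum_add_distrib, Finset.mul_sum]; exact Finset.sum_congr rfl fun z _ => by ring
      _ ≤ 6 * (36 * (3 : ℝ) * Mass + (12 * Mass + 4 * (36 * (3 : ℝ) * Mass))) := by gcongr
      _ = 3312 * Mass := by ring
  calc _ ≤ ∑ z ∈ B, (8 * τ₁ ^ 2 * (((Site.tdist z y : ℕ) : ℝ) ^ 2 * (∑ μ : Fin P.d, (‖covD (torusT P i) U μ V z‖ + ‖covD (torusT P i) U μ V (z.unshift μ)‖)) ^ 2)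
        + 2 * (2 * τ₂ + 8 * τ₁ ^ 2) ^ 2 * (((Site.tdist z y : ℕ) : ℝ) ^ 2 * (∑ μ : Fin P.d, (‖V (z.shift μ)‖ + ‖V z‖ + ‖V (z.unshift μ)‖)) ^ 2)) :=
        Finset.sum_le_sum hsq
    _ = 8 * τ₁ ^ 2 * ∑ z ∈ B, ((Site.tdist z y : ℕ) : ℝ) ^ 2 * (∑ μ : Fin P.d, (‖covD (torusT P i) U μ V z‖ + ‖covD (torusT P i) U μ V (z.unshift μ)‖)) ^ 2
        + 2 * (2 * τ₂ + 8 * τ₁ ^ 2) ^ 2 * ∑ z ∈ B, ((Site.tdist z y : ℕ) : ℝ) ^ 2 * (∑ μ : Fin P.d, (‖V (z.shift μ)‖ + ‖V z‖ + ‖V (z.unshift μ)‖)) ^ 2 := by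
        rw [Finset.sum_add_distrib, ← Finset.mul_sum, ← Finset.mul_sum]
    _ ≤ 8 * τ₁ ^ 2 * (3312 * Mass) + 2 * (2 * τ₂ + 8 * τ₁ ^ 2) ^ 2 * (81 * (m : ℝ) ^ 2 * Mass) := by gcongr
    _ = _ := by ring

/-! ## §3 ★★ The charge comparison at the pin -/

/-- ★★ **THE FLAT LAPLACIAN OF THE FRAMED FIELD AT THE PIN**: with the rows `τ₁` at `y`, `y − e_μ` and the backward difference `τ₂` at `y`,
`‖Δ₁(R(Fr⁻¹)V)(y)‖ ≤ ‖(Δ_UV)(y)‖ + (12τ₁ + 6τ₂ + 12τ₁²)·√𝓜` (`‖Δ₁v‖ ≤ ‖Δ_hv‖ + ‖Δ_hv − Δ₁v‖`, isometry, the comparison row with every field value `≤ √𝓜` and every first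
difference `≤ 2√𝓜`; `d = 3`). [cite: Balaban1985BackgroundPropagators, (3.8) p.392, (3.35) p.396] -/
theorem norm_laplace_framed_centre_le (hd : P.d = 3)
    (hU : ∀ (κ : Fin P.d) (w : Site P i), ‖(U κ w : Matrix (Fin N) (Fin N) ℂ)‖ ≤ 1 ∧ ‖(((U κ w)⁻¹ : (Matrix (Fin N) (Fin N) ℂ)ˣ) : Matrix (Fin N) (Fin N) ℂ)‖ ≤ 1)
    (hFr : ∀ z, ‖(Fr z : Matrix (Fin N) (Fin N) ℂ)‖ ≤ 1 ∧ ‖(((Fr z)⁻¹ : (Matrix (Fin N) (Fin N) ℂ)ˣ) : Matrix (Fin N) (Fin N) ℂ)‖ ≤ 1)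
    (V : Site P i → Matrix (Fin N) (Fin N) ℂ) (y : Site P i) {m : ℕ} (hm : 1 ≤ m) {τ₁ τ₂ : ℝ}
    (h1 : ∀ μ, ‖(((Fr y)⁻¹ * U μ y * Fr (torusT P i μ y) : (Matrix (Fin N) (Fin N) ℂ)ˣ) : Matrix (Fin N) (Fin N) ℂ) - 1‖ ≤ τ₁)
    (h1' : ∀ μ, ‖(((Fr (y.unshift μ))⁻¹ * U μ (y.unshift μ) * Fr (torusT P i μ (y.unshift μ)) : (Matrix (Fin N) (Fin N) ℂ)ˣ) : Matrix (Fin N) (Fin N) ℂ) - 1‖ ≤ τ₁)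
    (h2 : ∀ μ, ‖(((Fr y)⁻¹ * U μ y * Fr (torusT P i μ y) : (Matrix (Fin N) (Fin N) ℂ)ˣ) : Matrix (Fin N) (Fin N) ℂ)
        - (((Fr (y.unshift μ))⁻¹ * U μ (y.unshift μ) * Fr (torusT P i μ (y.unshift μ)) : (Matrix (Fin N) (Fin N) ℂ)ˣ) : Matrix (Fin N) (Fin N) ℂ)‖ ≤ τ₂) :
    ‖laplace 1 (fun w => R (Fr w)⁻¹ (V w)) y‖
      ≤ ‖divB (torusT P i) U (fun μ => covD (torusT P i) U μ V) y‖
        + (12 * τ₁ + 6 * τ₂ + 12 * τ₁ ^ 2) * Real.sqrt (∑ z ∈ Finset.univ.filter (fun z : Site P i => Site.tdist z y ≤ 2 * m + 1), ∑ j : Fin N, ∑ k : Fin N, ‖(V z) j k‖ ^ 2) := by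
  classical
  set h : Fin P.d → Site P i → (Matrix (Fin N) (Fin N) ℂ)ˣ := fun κ w => (Fr w)⁻¹ * U κ w * Fr (torusT P i κ w) with hh
  set v : Site P i → Matrix (Fin N) (Fin N) ℂ := fun w => R (Fr w)⁻¹ (V w) with hv
  set q := Real.sqrt (∑ z ∈ Finset.univ.filter (fun z : Site P i => Site.tdist z y ≤ 2 * m + 1), ∑ j : Fin N, ∑ k : Fin N, ‖(V z) j k‖ ^ 2) with hq
  have hq0 : 0 ≤ q := Real.sqrt_nonneg _
  have hτ₁ : 0 ≤ τ₁ := (norm_nonneg _).trans (h1 ⟨0, P.hd⟩)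
  have hτ₂ : 0 ≤ τ₂ := (norm_nonneg _).trans (h2 ⟨0, P.hd⟩)
  have hbic := framedLink_bicontr U Fr hU hFr
  have hframe : R (Fr y)⁻¹ (divB (torusT P i) U (fun μ => covD (torusT P i) U μ V) y) = divB (torusT P i) h (fun μ => covD (torusT P i) h μ v) y :=
    R_inv_frame_covLaplace (torusT P i) U Fr V y
  have hiso : ‖divB (torusT P i) h (fun μ => covD (torusT P i) h μ v) y‖ = ‖divB (torusT P i) U (fun μ => covD (torusT P i) U μ V) y‖ := by
    rw [← hframe]; exact norm_R_eq (hFr y).2 (by rw [inv_inv]; exact (hFr y).1) _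
  have hcmp := norm_covLaplace_sub_laplace_one_le_T h hbic v y (τ₁ := τ₁) (τ₂ := τ₂) h1 h1' h2
  have hmass_pt : ∀ w, Site.tdist w y ≤ 2 * m + 1 → ‖V w‖ ≤ q := fun w hw => norm_le_sqrt_mass V y (2 * m + 1) w hw
  -- triangle: `‖Δ₁v‖ ≤ ‖Δ_hv‖ + ‖Δ_hv − Δ₁v‖`
  have htri : ‖laplace 1 v y‖ ≤ ‖divB (torusT P i) h (fun μ => covD (torusT P i) h μ v) y‖
      + ‖divB (torusT P i) h (fun μ => covD (torusT P i) h μ v) y - laplace 1 v y‖ := by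
    calc ‖laplace 1 v y‖ = ‖divB (torusT P i) h (fun μ => covD (torusT P i) h μ v) y - (divB (torusT P i) h (fun μ => covD (torusT P i) h μ v) y - laplace 1 v y)‖ := by
          rw [sub_sub_cancel]
      _ ≤ _ := norm_sub_le _ _
  rw [hiso] at htri
  refine htri.trans (add_le_add le_rfl (hcmp.trans ?_))
  -- each summand: `2τ₁‖v₊ − v₋‖ + (2τ₂+4τ₁²)‖v₋‖ ≤ 2τ₁·(2q + 2τ₁ q + 2q + 2τ₁ q)… ≤ (4τ₁ + 2τ₂ + 4τ₁²)·… `; crude: `‖v(y±e_μ)‖ = ‖V(y±e_μ)‖ ≤ q`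
  have hpt : ∀ μ : Fin P.d, 2 * τ₁ * ‖v (y.shift μ) - v (y.unshift μ)‖ + (2 * τ₂ + 4 * τ₁ ^ 2) * ‖v (y.unshift μ)‖ ≤ (4 * τ₁ + 2 * τ₂ + 4 * τ₁ ^ 2) * q := by
    intro μ
    have hs1 : Site.tdist (y.shift μ) y ≤ 2 * m + 1 := by have := tdist_shift_le_succ y y μ; rw [tdist_self] at this; omega
    have hu1 : Site.tdist (y.unshift μ) y ≤ 2 * m + 1 := by have := tdist_unshift_le_succ y y μ; rw [tdist_self] at this; omega
    have hvp : ‖v (y.shift μ)‖ ≤ q := by rw [hv]; dsimp only; rw [norm_framed_eq Fr hFr V]; exact hmass_pt _ hs1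
    have hvm : ‖v (y.unshift μ)‖ ≤ q := by rw [hv]; dsimp only; rw [norm_framed_eq Fr hFr V]; exact hmass_pt _ hu1
    have hdiff : ‖v (y.shift μ) - v (y.unshift μ)‖ ≤ 2 * q := (norm_sub_le _ _).trans (by linarith)
    have hc : 0 ≤ 2 * τ₂ + 4 * τ₁ ^ 2 := by positivity
    nlinarith [mul_le_mul_of_nonneg_left hdiff (by positivity : 0 ≤ 2 * τ₁), mul_le_mul_of_nonneg_left hvm hc]
  calc ∑ μ : Fin P.d, (2 * τ₁ * ‖v (y.shift μ) - v (y.unshift μ)‖ + (2 * τ₂ + 4 * τ₁ ^ 2) * ‖v (y.unshift μ)‖)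
      ≤ ∑ _μ : Fin P.d, (4 * τ₁ + 2 * τ₂ + 4 * τ₁ ^ 2) * q := Finset.sum_le_sum fun μ _ => hpt μ
    _ = (12 * τ₁ + 6 * τ₂ + 12 * τ₁ ^ 2) * q := by
        rw [Finset.sum_const, Finset.card_univ, Fintype.card_fin, nsmul_eq_mul, hd]; push_cast; ring

end Main

end Summit.QuantumFields.YangMills.Theorems.Prop7CovPinJunkPhiSq

end
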